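import Summits.ResolutionOfSingularities.ResolutionOfSingularities.Theorems.EquisingularLiftEquisingularLiftNatIdleVariables
import Summits.ResolutionOfSingularities.ResolutionOfSingularities.Theorems.EquisingularLiftEquisingularLiftNatSpecimenConeChartsAllN
import HarnessLib

/-!
# [OURS · L1 W4.5(b)] CONES WITH A LINEAR VERTEX, ANY DIMENSION — THE CHARTS: `H = V₊(G(x_{ι 0},…,x_{ι (m+1)})) ⊂ ℙⁿ⁺¹_k`, vertex the
# coordinate subspace of the complementary variables `x_{e 0}, …, x_{e r}` (crux `Theses.EquisingularLift.EquisingularLiftNat`, stmt-ResolutionOfSingularities-20038)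

NOT a statement of any manuscript; OURS kernel lemmas (cell `res-hironaka`, chain w45b; seat res-D-pv-013, own initiative, counted 0). AI-written,
weaker than expert review. No definition, no `sorry`, standard axioms.

Setting: `G ∈ k[T₀,…,T_{m+1}]`; two injective maps `ι : Fin (m+2) → Fin (n+2)` (the variables of the cone form `F = rename ι G`) and
`e : Fin (r+1) → Fin (n+2)` (the SURVIVING variables = the cone directions; the vertex is `L = V(x_a : a ∉ range e) ≅ ℙʳ`), complementary:
`ι l ∉ range e` and `a ∉ range e ⇒ a ∈ range ι`. (The standard instance is `ι = Fin.natAdd (r+1)`, `e = Fin.castAdd (m+2)` in `ℙ^{r+m+2}`: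
`LinCone.natAdd_not_mem_range_castAdd`, `exists_eq_natAdd_of_not_mem_range`.)

* `LinCone.exists_tau_vertex`, `dehomogenize_vertex` — on a vertex chart `x_{e i} = 1`: `F(x_{e i} := 1) = rename τ G` (the cone variables are chart
  coordinates `y_{τ l}`, the other chart coordinates idle); `LinCone.exists_tau_off`, `dehomogenize_off` — off the vertex, `x_{ι c'} = 1`:
  `F(x_{ι c'} := 1) = rename τ (G(T)|_{T_{c'} := 1})` (the slot `c'` becomes the idle coordinate `x_{e 0}/x_{ι c'}`);
* `LinCone.isRegularRing_chartRing_off` — the chart rings off the vertex are regular (`IdleVar.isRegularRing_quotient_rename`, p538222);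
* **`LinCone.isRegularRing_blowupAlgebra_vertex`** — on a vertex chart the affine blow-up algebras of `ChartRing F (e i) ≅ (k[T]/(G))[y']` along
  `(T̄)` at `T̄_l` are regular: `IdleVar.isRegularRing_blowupAlgebra_mvPolynomial` (Stacks 0805) over the all-n vertex chart
  `ConeN.isRegularRing_vertexChart_of_isHomogeneous` (p532732).

References: The Stacks Project 0805, 0804; Görtz–Wedhorn I 13.91, 13.96 — through the cited tree files.
-/

set_option linter.dupNamespace false -- mandated namespace `Summit.<Summit>.<Problem>` of this single-conjunct summit

noncomputable section

open MvPolynomial HomogeneousLocalization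
open Literature.AlgebraicGeometry.Resolution
open Literature.AlgebraicGeometry.Motives Literature.AlgebraicGeometry.Motives.SmoothHypersurface
open Literature.AlgebraicGeometry.Motives.ProjectiveSpace

namespace Summit.ResolutionOfSingularities.ResolutionOfSingularities.Cruxes.EquisingularLiftNat.Sections

namespace LinCone

/-! ## The standard instance: cone variables `x_{r+1+l}`, cone directions `x_i` (`i ≤ r`) -/

/-- `x_{r+1+l}` is not a cone direction. [folklore] -/
theorem natAdd_not_mem_range_castAdd {r m : ℕ} (l : Fin (m + 2)) :
    (Fin.natAdd (r + 1) l : Fin (r + 1 + m + 2)) ∉ Set.range (Fin.castAdd (m + 2) : Fin (r + 1) → Fin (r + 1 + m + 2)) := by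
  rintro ⟨i, hi⟩
  have h := congrArg Fin.val hi
  simp only [Fin.val_castAdd, Fin.val_natAdd] at h
  have := i.2
  omega

/-- A variable that is not a cone direction is one of the `x_{r+1+l}`. [folklore] -/
theorem exists_eq_natAdd_of_not_mem_range {r m : ℕ} {a : Fin (r + 1 + m + 2)}
    (ha : a ∉ Set.range (Fin.castAdd (m + 2) : Fin (r + 1) → Fin (r + 1 + m + 2))) :
    a ∈ Set.range (Fin.natAdd (r + 1) : Fin (m + 2) → Fin (r + 1 + m + 2)) := by
  have hsa : a = (finSumFinEquiv (m := r + 1) (n := m + 2)) ((finSumFinEquiv (m := r + 1) (n := m + 2)).symm a) :=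
    ((finSumFinEquiv (m := r + 1) (n := m + 2)).apply_symm_apply a).symm
  rcases hs : (finSumFinEquiv (m := r + 1) (n := m + 2)).symm a with i | l
  · rw [hs, finSumFinEquiv_apply_left] at hsa
    exact absurd ⟨i, hsa.symm⟩ ha
  · rw [hs, finSumFinEquiv_apply_right] at hsa
    exact ⟨l, hsa.symm⟩

/-! ## The general setting -/

variable (k : Type) [Field k] {n r m : ℕ} (ι : Fin (m + 2) → Fin (n + 2)) (hι : Function.Injective ι)
  (e : Fin (r + 1) → Fin (n + 2)) (hιe : ∀ l, ι l ∉ Set.range e) (heι : ∀ a, a ∉ Set.range e → a ∈ Set.range ι)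
  (G : MvPolynomial (Fin (m + 2)) k) {d : ℕ} (hG : G.IsHomogeneous d)
  (hF : (rename ι G).IsHomogeneous d) (hd : 0 < d) (hGp : Prime G)
  (hreg : ∀ i : Fin (m + 2), IsRegularRing (MvPolynomial (Fin (m + 2)) k ⧸
    Ideal.span {aeval (Function.update (X : Fin (m + 2) → MvPolynomial (Fin (m + 2)) k) i 1) G}))

attribute [local instance] MvPolynomial.gradedAlgebra ProjBaseChange.algebraBase

/-! ## The dehomogenised equations -/

include hι hιe in
/-- On the vertex chart `x_{e i} = 1`: every cone variable `x_{ι l}` is a chart coordinate `y_{τ l}` (injectively). [folklore] -/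
theorem exists_tau_vertex (i : Fin (r + 1)) :
    ∃ τ : Fin (m + 2) → Fin (n + 1), Function.Injective τ ∧ ∀ l, (e i).succAbove (τ l) = ι l := by
  have h : ∀ l : Fin (m + 2), ι l ≠ e i := fun l hl => hιe l ⟨i, hl.symm⟩
  choose τ hτ using fun l => Fin.exists_succAbove_eq (h l)
  refine ⟨τ, fun a b hab => ?_, hτ⟩
  have h1 := hτ a
  rw [hab, hτ b] at h1
  exact hι h1.symm

/-- **`F(x_{e i} := 1) = rename τ G`** on a vertex chart. [folklore] -/
theorem dehomogenize_vertex (i : Fin (r + 1)) (τ : Fin (m + 2) → Fin (n + 1)) (hτ : ∀ l, (e i).succAbove (τ l) = ι l) :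
    dehomogenize k (e i) (rename ι G) = rename τ G := by
  have h := MvPolynomial.algHom_ext (A := MvPolynomial (Fin (n + 1)) k)
    (f := (dehomogenize k (e i)).comp (rename ι : MvPolynomial (Fin (m + 2)) k →ₐ[k] MvPolynomial (Fin (n + 2)) k))
    (g := rename τ) fun l => by
      rw [AlgHom.comp_apply, rename_X, rename_X, ← hτ l, dehomogenize_X_succAbove]
  exact DFunLike.congr_fun h G

include hι hιe in
/-- Off the vertex, chart `x_{ι c'} = 1`: the other cone variables are chart coordinates `y_{τ l}` and the slot `c'` is sent to the idle
coordinate `x_{e 0}/x_{ι c'}` (so that `τ` is injective). [folklore] -/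
theorem exists_tau_off (c' : Fin (m + 2)) :
    ∃ τ : Fin (m + 2) → Fin (n + 1), Function.Injective τ ∧
      (∀ l, l ≠ c' → (ι c').succAbove (τ l) = ι l) ∧ (ι c').succAbove (τ c') = e 0 := by
  classical
  let g : Fin (m + 2) → Fin (n + 2) := fun l => if l = c' then e 0 else ι l
  have hg : ∀ l, g l ≠ ι c' := by
    intro l hl
    by_cases hlc : l = c'
    · simp only [g, if_pos hlc] at hl
      exact hιe c' ⟨0, hl⟩
    · simp only [g, if_neg hlc] at hl
      exact hlc (hι hl)
  have hginj : Function.Injective g := by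
    intro a b hab
    by_cases ha : a = c' <;> by_cases hb : b = c'
    · rw [ha, hb]
    · simp only [g, if_pos ha, if_neg hb] at hab
      exact absurd ⟨0, hab⟩ (hιe b)
    · simp only [g, if_neg ha, if_pos hb] at hab
      exact absurd ⟨0, hab.symm⟩ (hιe a)
    · simp only [g, if_neg ha, if_neg hb] at hab
      exact hι hab
  choose τ hτ using fun l => Fin.exists_succAbove_eq (hg l)
  refine ⟨τ, fun a b hab => hginj ?_, fun l hl => ?_, ?_⟩
  · rw [← hτ a, ← hτ b, hab]
  · rw [hτ l]
    simp only [g, if_neg hl]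
  · rw [hτ c']
    simp only [g, if_pos rfl]

/-- **`F(x_{ι c'} := 1) = rename τ (G(T)|_{T_{c'} := 1})`** off the vertex. [folklore] -/
theorem dehomogenize_off (c' : Fin (m + 2)) (τ : Fin (m + 2) → Fin (n + 1)) (hτ : ∀ l, l ≠ c' → (ι c').succAbove (τ l) = ι l) :
    dehomogenize k (ι c') (rename ι G) =
      rename τ (aeval (Function.update (X : Fin (m + 2) → MvPolynomial (Fin (m + 2)) k) c' 1) G) := by
  have h := MvPolynomial.algHom_ext (A := MvPolynomial (Fin (n + 1)) k)
    (f := (dehomogenize k (ι c')).comp (rename ι : MvPolynomial (Fin (m + 2)) k →ₐ[k] MvPolynomial (Fin (n + 2)) k))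
    (g := (rename τ).comp (aeval (Function.update (X : Fin (m + 2) → MvPolynomial (Fin (m + 2)) k) c' 1))) fun l => by
      rw [AlgHom.comp_apply, rename_X, AlgHom.comp_apply, aeval_X]
      by_cases hl : l = c'
      · subst hl
        rw [Function.update_self, map_one, dehomogenize_X_self]
      · rw [Function.update_of_ne hl, rename_X, ← hτ l hl, dehomogenize_X_succAbove]
  have h' := DFunLike.congr_fun h G
  rw [AlgHom.comp_apply, AlgHom.comp_apply] at h'
  exact h'

/-! ## The chart rings off the vertex are regular -/

include hι hιe hreg in
/-- **The chart rings off the vertex are regular**: `ChartRing F (ι c') ≅ k[y]/(rename τ (G|_{T_{c'} := 1}))`, regular by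
`IdleVar.isRegularRing_quotient_rename`. [folklore] -/
theorem isRegularRing_chartRing_off (c' : Fin (m + 2)) : IsRegularRing (ChartRing (rename ι G) (ι c') hF) := by
  obtain ⟨τ, hτinj, hτ, -⟩ := exists_tau_off ι hι e hιe c'
  set g := aeval (Function.update (X : Fin (m + 2) → MvPolynomial (Fin (m + 2)) k) c' 1) G with hg
  haveI hR : IsRegularRing (MvPolynomial (Fin (n + 1)) k ⧸ Ideal.span {rename τ g}) :=
    IdleVar.isRegularRing_quotient_rename τ hτinj g (hreg c')
  have hrad : (Ideal.span {rename τ g}).radical = Ideal.span {rename τ g} := by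
    haveI := IsRegularRing.isReduced' (MvPolynomial (Fin (n + 1)) k ⧸ Ideal.span {rename τ g})
    exact (Ideal.isRadical_iff_quotient_reduced _).mpr inferInstance |>.radical
  obtain ⟨θ, -⟩ := HypersurfaceSpecimen.exists_chartQuotEquiv (rename ι G) hF (ι c') (rename τ g) (dehomogenize_off k ι G c' τ hτ) hrad
  exact IsRegularRing.of_ringEquiv θ.symm

/-! ## The blow-up chart rings over the vertex charts are regular -/

include hι hιe heι hG hGp hreg in
/-- **The blow-up chart rings over a vertex chart are regular**: on `x_{e i} = 1`, `ChartRing F (e i) ≅ k[y]/(rename τ G) ≅ (k[T]/(G))[y']`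
(`IdleVar.exists_quotient_rename_equiv`) with the centre `(x_a/x_{e i} : a ∉ range e) ↦ (T̄)` and `x_{ι l}/x_{e i} ↦ T̄_l`; the affine blow-up
algebra is `((k[T]/(G))[T̄/T̄_l])[y']` (Stacks 0805, `IdleVar.isRegularRing_blowupAlgebra_mvPolynomial`), regular by the all-n vertex chart
`ConeN.isRegularRing_vertexChart_of_isHomogeneous`. [cite: StacksProject, Tag 0805] -/
theorem isRegularRing_blowupAlgebra_vertex (i : Fin (r + 1)) (a : {a : Fin (n + 2) // a ∉ Set.range e}) :
    IsRegularRing (blowupAlgebra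
      (Ideal.span (Set.range fun a' : {a' : Fin (n + 2) // a' ∉ Set.range e} => tautVec (rename ι G) (e i) hF a'.1))
      (tautVec (rename ι G) (e i) hF a.1)) := by
  obtain ⟨τ, hτinj, hτ⟩ := exists_tau_vertex ι hι e hιe i
  have hrad : (Ideal.span {rename τ G}).radical = Ideal.span {rename τ G} :=
    ((Ideal.span_singleton_prime (IdleVar.prime_rename τ hτinj hGp).ne_zero).mpr (IdleVar.prime_rename τ hτinj hGp)).radical
  obtain ⟨θ₁, hθ₁⟩ := HypersurfaceSpecimen.exists_chartQuotEquiv (rename ι G) hF (e i) (rename τ G) (dehomogenize_vertex k ι e G i τ hτ) hrad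
  obtain ⟨θ₂, hθ₂⟩ := IdleVar.exists_quotient_rename_equiv (R := k) τ hτinj G
  set A := MvPolynomial (Fin (m + 2)) k ⧸ Ideal.span {G} with hA
  let θ := θ₁.trans θ₂
  -- the generators `x_{ι l}/x_{e i}` go to the constants `T̄_l`
  have hgen : ∀ l : Fin (m + 2), θ (tautVec (rename ι G) (e i) hF (ι l)) =
      algebraMap A (MvPolynomial ((Set.range τ)ᶜ : Set (Fin (n + 1))) A) (Ideal.Quotient.mk _ (X l)) := by
    intro l
    rw [MvPolynomial.algebraMap_eq]
    have h2 := hθ₂ (X l)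
    rw [rename_X] at h2
    change θ₂ (θ₁ (tautVec (rename ι G) (e i) hF (ι l))) = _
    rw [← hτ l, hθ₁ (τ l)]
    exact h2
  obtain ⟨l₀, hl₀⟩ := heι a.1 a.2
  refine WhitneyCubic.isRegularRing_blowupAlgebra_of_ringEquiv (S := MvPolynomial ((Set.range τ)ᶜ : Set (Fin (n + 1))) A) θ _ _ ?_
  have hrange : Set.range (⇑θ.toRingHom ∘ fun a' : {a' : Fin (n + 2) // a' ∉ Set.range e} => tautVec (rename ι G) (e i) hF a'.1) =
      Set.range (⇑(algebraMap A (MvPolynomial ((Set.range τ)ᶜ : Set (Fin (n + 1))) A)) ∘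
        (⇑(Ideal.Quotient.mk (Ideal.span {G})) ∘ (MvPolynomial.X : Fin (m + 2) → MvPolynomial (Fin (m + 2)) k))) := by
    ext q
    constructor
    · rintro ⟨a', rfl⟩
      obtain ⟨l', hl'⟩ := heι a'.1 a'.2
      refine ⟨l', ?_⟩
      simp only [Function.comp_apply, RingEquiv.toRingHom_eq_coe, RingHom.coe_coe]
      rw [← hl', hgen l']
    · rintro ⟨l', rfl⟩
      refine ⟨⟨ι l', hιe l'⟩, ?_⟩
      simp only [Function.comp_apply, RingEquiv.toRingHom_eq_coe, RingHom.coe_coe]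
      exact hgen l'
  have hI : (Ideal.span (Set.range fun a' : {a' : Fin (n + 2) // a' ∉ Set.range e} => tautVec (rename ι G) (e i) hF a'.1)).map θ.toRingHom =
      ((PointBlowup.originIdeal (m + 1) k).map (Ideal.Quotient.mk (Ideal.span {G}))).map
        (algebraMap A (MvPolynomial ((Set.range τ)ᶜ : Set (Fin (n + 1))) A)) := by
    change _ = Ideal.map _ (Ideal.map _ (Ideal.span (Set.range MvPolynomial.X)))
    rw [Ideal.map_span, Ideal.map_span, Ideal.map_span, ← Set.range_comp, hrange, Set.range_comp, Set.range_comp]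
  rw [hI]
  have hb : θ (tautVec (rename ι G) (e i) hF a.1) = algebraMap A _ (Ideal.Quotient.mk _ (X l₀)) := by
    rw [← hl₀]
    exact hgen l₀
  rw [hb]
  exact IdleVar.isRegularRing_blowupAlgebra_mvPolynomial _ _
    (ConeN.isRegularRing_vertexChart_of_isHomogeneous k G l₀ hG hGp.ne_zero (hreg l₀))

end LinCone

end Summit.ResolutionOfSingularities.ResolutionOfSingularities.Cruxes.EquisingularLiftNat.Sections

end
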